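import Mathlib.Algebra.MonoidAlgebra.MapDomain
import Mathlib.Algebra.MonoidAlgebra.Basic
import Mathlib.RingTheory.Localization.AtPrime.Basic
import Mathlib.RingTheory.Localization.LocalizationLocalization
import Mathlib.RingTheory.RegularLocalRing.Defs
import Mathlib.RingTheory.RegularLocalRing.Polynomial
import Mathlib.RingTheory.MvPolynomial.Basic
import Mathlib.LinearAlgebra.FreeModule.PID
import Mathlib.LinearAlgebra.Dimension.Finrank
import Literature.AlgebraicGeometry.Resolution.RegularCentreLocal
import HarnessLib

/-!
# Monoid algebras: the group algebra `k[Qᵍᵖ]` is a localization of `k[Q]`; Laurent rings are regular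

Support file for crux stmt-ResolutionOfSingularities-15317 (`FrobeniusLadder.FRationalResolution`), line `redirect`,
brick L5 of the leaf hands' census (log regularity of the toric algebras `k[P]`, hence resolution of all affine
normal toric varieties over all fields by the tree's PROVED Kato 1994 (10.4)). Pure commutative algebra:

* `isLocalization_of_mapDomain` — for an injective monoid homomorphism `ι : Q → Γ` into a commutative group all of
  whose elements are differences `ι a − ι b`, the group algebra `k[Γ]` is the localization of `k[Q]` at the
  monomials (`k[Q] → k[Γ]` = `mapDomain ι`);
* `isRegularLocalRing_localization_atPrime_of_isLocalization_of_disjoint` — if `S` is a localization of `R` at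
  `M` and `S` is a regular ring, the local rings of `R` at primes disjoint from `M` are regular;
* `isRegularRing_addMonoidAlgebra_finsupp_int` — the Laurent polynomial ring `k[ℤ^r] = k[Fin r →₀ ℤ]` over a
  regular ring `k` is a regular ring (a localization of `k[X₁, …, X_r]`);
* `isRegularRing_addMonoidAlgebra_of_free` — so is `k[Γ]` for every finitely generated free abelian group `Γ`.

All folklore; no published fact is used.
-/

-- single-problem summit: the doubled namespace component is forced
set_option linter.dupNamespace false

noncomputable section

namespace Summit.ResolutionOfSingularities.ResolutionOfSingularities.Theorems.FRationalResolution

open AddMonoidAlgebra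

universe u v w

section Localization

variable (k : Type u) [CommRing k] {Q : Type v} {Γ : Type w} [AddCommMonoid Q] [AddCommGroup Γ]

/-- **`k[Γ]` is the localization of `k[Q]` at its monomials** when `ι : Q ↪ Γ` is an injective monoid
homomorphism into a commutative group every element of which is a difference of elements of `ι(Q)` (e.g.
`Γ = Qᵍᵖ` for cancellative `Q`), the algebra structure being `mapDomain ι`. [folklore] -/
theorem isLocalization_of_mapDomain (ι : Q →+ Γ) (hι : Function.Injective ι)
    (hgen : ∀ γ : Γ, ∃ a b : Q, γ + ι b = ι a)
    [Algebra (AddMonoidAlgebra k Q) (AddMonoidAlgebra k Γ)]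
    (halg : (algebraMap (AddMonoidAlgebra k Q) (AddMonoidAlgebra k Γ) :
      AddMonoidAlgebra k Q →+* AddMonoidAlgebra k Γ) = mapDomainRingHom k ι) :
    IsLocalization (MonoidHom.mrange (AddMonoidAlgebra.of k Q)) (AddMonoidAlgebra k Γ) := by
  have happ : ∀ x : AddMonoidAlgebra k Q,
      algebraMap (AddMonoidAlgebra k Q) (AddMonoidAlgebra k Γ) x = AddMonoidAlgebra.mapDomain ι x := fun x => by
    rw [halg]; rfl
  have hsingle : ∀ (q : Q) (c : k), algebraMap (AddMonoidAlgebra k Q) (AddMonoidAlgebra k Γ)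
      (AddMonoidAlgebra.single q c) = AddMonoidAlgebra.single (ι q) c := fun q c => by
    rw [happ, AddMonoidAlgebra.mapDomain_single]
  rw [isLocalization_iff]
  refine ⟨?_, ?_, ?_⟩
  · rintro ⟨_, q, rfl⟩
    change IsUnit (algebraMap (AddMonoidAlgebra k Q) (AddMonoidAlgebra k Γ) (AddMonoidAlgebra.of k Q q))
    rw [AddMonoidAlgebra.of_apply, hsingle, ← toAdd_ofAdd (ι (Multiplicative.toAdd q)),
      ← AddMonoidAlgebra.of_apply]
    exact Group.isUnit _ |>.map _
  · intro z
    induction z using AddMonoidAlgebra.induction_linear with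
    | zero => exact ⟨(0, 1), by simp⟩
    | add f g hf hg =>
      obtain ⟨⟨x₁, m₁⟩, h₁⟩ := hf
      obtain ⟨⟨x₂, m₂⟩, h₂⟩ := hg
      refine ⟨(x₁ * (m₂ : AddMonoidAlgebra k Q) + x₂ * (m₁ : AddMonoidAlgebra k Q), m₁ * m₂), ?_⟩
      simp only [Submonoid.coe_mul, map_mul, map_add] at h₁ h₂ ⊢
      rw [add_mul, ← mul_assoc, h₁, mul_comm (algebraMap _ _ (m₁ : AddMonoidAlgebra k Q)), ← mul_assoc, h₂]
    | single γ c =>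
      obtain ⟨a, b, hab⟩ := hgen γ
      refine ⟨(AddMonoidAlgebra.single a c, ⟨AddMonoidAlgebra.of k Q (Multiplicative.ofAdd b), b, rfl⟩), ?_⟩
      change AddMonoidAlgebra.single γ c * algebraMap _ _ (AddMonoidAlgebra.of k Q (Multiplicative.ofAdd b)) =
        algebraMap _ _ (AddMonoidAlgebra.single a c)
      rw [AddMonoidAlgebra.of_apply, toAdd_ofAdd, hsingle, hsingle, AddMonoidAlgebra.single_mul_single, mul_one,
        hab]
  · intro x y hxy
    refine ⟨1, ?_⟩
    rw [happ, happ] at hxy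
    rw [AddMonoidAlgebra.mapDomain_injective hι hxy]

end Localization

section Regular

/-- If `S` is a localization of `R` at `M` and `S` is a regular ring, then for every prime `𝔮` of `R` disjoint
from `M` the local ring `R_𝔮` (`≅ S_{𝔮S}`) is a regular local ring. [folklore] -/
theorem isRegularLocalRing_localization_atPrime_of_isLocalization_of_disjoint {R : Type u} [CommRing R]
    (M : Submonoid R) (S : Type v) [CommRing S] [Algebra R S] [IsLocalization M S] [IsRegularRing S]
    (𝔮 : Ideal R) [𝔮.IsPrime] (hdisj : Disjoint (M : Set R) (𝔮 : Set R)) :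
    IsRegularLocalRing (Localization.AtPrime 𝔮) := by
  haveI h𝔔 : (𝔮.map (algebraMap R S)).IsPrime := IsLocalization.isPrime_of_isPrime_disjoint M S 𝔮 ‹_› hdisj
  set 𝔔 := 𝔮.map (algebraMap R S) with h𝔔def
  have hT : IsLocalization.AtPrime (Localization.AtPrime 𝔔) (𝔔.comap (algebraMap R S)) :=
    IsLocalization.isLocalization_isLocalization_atPrime_isLocalization M (Localization.AtPrime 𝔔) 𝔔
  have hcomap : 𝔔.comap (algebraMap R S) = 𝔮 := IsLocalization.under_map_of_isPrime_disjoint M S ‹_› hdisj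
  have hpc : (𝔔.comap (algebraMap R S)).primeCompl = 𝔮.primeCompl := by
    ext x
    change x ∉ 𝔔.comap (algebraMap R S) ↔ x ∉ 𝔮
    rw [hcomap]
  haveI : IsLocalization.AtPrime (Localization.AtPrime 𝔔) 𝔮 := by
    change IsLocalization 𝔮.primeCompl (Localization.AtPrime 𝔔)
    rw [← hpc]
    exact hT
  haveI : IsRegularLocalRing (Localization.AtPrime 𝔔) := IsRegularRing.isRegularLocalRing_localization 𝔔
  exact IsRegularLocalRing.of_ringEquiv
    (IsLocalization.algEquiv 𝔮.primeCompl (Localization.AtPrime 𝔔) (Localization.AtPrime 𝔮)).toRingEquiv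

variable (k : Type u) [CommRing k]

/-- The inclusion `ℕ^r ↪ ℤ^r` of exponent monoids (coordinatewise `Nat.cast`). [folklore] -/
theorem finsuppNatCast_injective (r : ℕ) :
    Function.Injective
      (Finsupp.mapRange.addMonoidHom (Nat.castAddMonoidHom ℤ) : (Fin r →₀ ℕ) →+ (Fin r →₀ ℤ)) := by
  intro x y hxy
  ext i
  have := DFunLike.congr_fun hxy i
  simpa using this

/-- Every `γ ∈ ℤ^r` is a difference of two elements of `ℕ^r`. [folklore] -/
theorem finsuppInt_exists_add_eq (r : ℕ) (γ : Fin r →₀ ℤ) :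
    ∃ a b : Fin r →₀ ℕ,
      γ + (Finsupp.mapRange.addMonoidHom (Nat.castAddMonoidHom ℤ) : (Fin r →₀ ℕ) →+ (Fin r →₀ ℤ)) b =
        (Finsupp.mapRange.addMonoidHom (Nat.castAddMonoidHom ℤ) : (Fin r →₀ ℕ) →+ (Fin r →₀ ℤ)) a := by
  refine ⟨γ.mapRange Int.toNat (by simp), (-γ).mapRange Int.toNat (by simp), ?_⟩
  ext i
  simp only [Finsupp.mapRange.addMonoidHom_apply, Finsupp.coe_add, Pi.add_apply, Finsupp.mapRange_apply,
    Nat.coe_castAddMonoidHom, Finsupp.coe_neg, Pi.neg_apply]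
  omega

/-- **The Laurent polynomial ring `k[ℤ^r] = k[Fin r →₀ ℤ]` over a regular ring is regular**: it is the
localization of the regular ring `k[X₁, …, X_r] = k[Fin r →₀ ℕ]` (Mathlib `MvPolynomial.isRegularRing_of_isRegularRing`)
at its monomials, and localizations of regular rings are regular. [folklore] -/
theorem isRegularRing_addMonoidAlgebra_finsupp_int [IsRegularRing k] (r : ℕ) :
    IsRegularRing (AddMonoidAlgebra k (Fin r →₀ ℤ)) := by
  let ι : (Fin r →₀ ℕ) →+ (Fin r →₀ ℤ) := Finsupp.mapRange.addMonoidHom (Nat.castAddMonoidHom ℤ)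
  letI : Algebra (AddMonoidAlgebra k (Fin r →₀ ℕ)) (AddMonoidAlgebra k (Fin r →₀ ℤ)) :=
    (mapDomainRingHom k ι).toAlgebra
  haveI : IsLocalization (MonoidHom.mrange (AddMonoidAlgebra.of k (Fin r →₀ ℕ)))
      (AddMonoidAlgebra k (Fin r →₀ ℤ)) :=
    isLocalization_of_mapDomain k ι (finsuppNatCast_injective r) (finsuppInt_exists_add_eq r) rfl
  haveI : IsRegularRing (AddMonoidAlgebra k (Fin r →₀ ℕ)) :=
    MvPolynomial.isRegularRing_of_isRegularRing k (ι := Fin r)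
  exact Literature.AlgebraicGeometry.Resolution.isRegularRing_of_isLocalization
    (MonoidHom.mrange (AddMonoidAlgebra.of k (Fin r →₀ ℕ))) (AddMonoidAlgebra k (Fin r →₀ ℤ))

/-- **The group algebra of a finitely generated free abelian group over a regular ring is regular**
(`k[Γ] ≅ k[ℤ^r]` along a basis). [folklore] -/
theorem isRegularRing_addMonoidAlgebra_of_free [IsRegularRing k] (Γ : Type v) [AddCommGroup Γ]
    [Module.Free ℤ Γ] [Module.Finite ℤ Γ] : IsRegularRing (AddMonoidAlgebra k Γ) := by
  let b := Module.finBasis ℤ Γ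
  let e : Γ ≃+ (Fin (Module.finrank ℤ Γ) →₀ ℤ) := b.repr.toAddEquiv
  haveI := isRegularRing_addMonoidAlgebra_finsupp_int k (Module.finrank ℤ Γ)
  exact IsRegularRing.of_ringEquiv (AddMonoidAlgebra.domCongr k k e).symm.toRingEquiv

end Regular

end Summit.ResolutionOfSingularities.ResolutionOfSingularities.Theorems.FRationalResolution

end
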